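import Mathlib
import Summits.NavierStokesRegularity.NavierStokesRegularity.Theses.FilamentSkeletonRss

/-!
# SkeletonJ1R — crux idea `curvature-parity-transfer`: first lemmas (sketch, ideator slot 3, g16)

The lever: the in-ball linearised normal self-induction of a filament is an EVEN functional of its
bending data `K = X''` (rotation by `π` about the datum line maps the bent arc to its mirror-bent
congruent copy and acts as `-1` on normal fields), so the TRUE Kelvin block differs from the
straight Rosenhead model of the lane (`MatchedKernel.model_l2_estimate_scaled`, constant `A`
Γ-free and `R_b`-free) by an operator of norm `O(Γ κ² log Γ) = O(R_b²)`; the crux's own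
`∃ R_b, Γ₂` then makes the true in-ball `L²` estimate a Neumann corollary.

* `NeumannTransfer` (P0, the logical spine; proved below);
* `ChordArcSecondOrder` (P1, Schur chord–arc comparison: the distance factor of the kernel has
  NO first-order term in the curvature bound, globally, using only `sup ‖X''‖`);
* `KernelDistanceFactorBound` (P2, the first checkable statement of the line: the Rosenhead
  distance factor `((‖X τ - X σ‖² + q)^{3/2})⁻¹` at a bent unit-speed arc differs from the straight
  one by `≤ 2 κ² (τ-σ)⁴ ((τ-σ)² + q)^{-5/2}`, i.e. relatively `O(κ² s²)` — second order).
-/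

namespace Summit.NavierStokesRegularity.NavierStokesRegularity.Cruxes.SkeletonJ1R.CurvatureParityTransfer

/-- P0 (spine). An a-priori estimate `‖y‖ ≤ A ‖M y‖` transfers to any `L` with
`‖M y - L y‖ ≤ ε ‖y‖` and `A ε ≤ 1/2`, with constant `2A`. -/
def NeumannTransfer : Prop :=
  ∀ (E : Type) [SeminormedAddCommGroup E] (L M : E → E) (A ε : ℝ), 0 ≤ A →
    (∀ y, ‖y‖ ≤ A * ‖M y‖) → (∀ y, ‖M y - L y‖ ≤ ε * ‖y‖) → A * ε ≤ 1 / 2 →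
    ∀ y, ‖y‖ ≤ 2 * A * ‖L y‖

theorem neumannTransfer_holds : NeumannTransfer := by
  intro E _ L M A ε hA hM hE hAε y
  have h1 := hM y
  have h2 := hE y
  have h3 : ‖M y‖ ≤ ‖L y‖ + ‖M y - L y‖ := by
    have := norm_add_le (L y) (M y - L y)
    simpa using this
  have h4 : ‖y‖ ≤ A * ‖L y‖ + A * ε * ‖y‖ := by
    calc ‖y‖ ≤ A * ‖M y‖ := h1
      _ ≤ A * (‖L y‖ + ε * ‖y‖) := by
          exact mul_le_mul_of_nonneg_left (le_trans h3 (by linarith)) hA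
      _ = A * ‖L y‖ + A * ε * ‖y‖ := by ring
  have h5 : A * ε * ‖y‖ ≤ 1 / 2 * ‖y‖ :=
    mul_le_mul_of_nonneg_right hAε (norm_nonneg _)
  nlinarith [norm_nonneg (L y), norm_nonneg y]

/-- P1 (Schur chord–arc comparison, second order and global). For a unit-speed `C²` arc with
`‖X''‖ ≤ κ`, on the range `κ |τ - σ| ≤ π` the squared-chord deficit is nonnegative and at most
`κ² (τ-σ)⁴ / 12` — there is no term linear in `κ`. -/
def ChordArcSecondOrder : Prop :=
  ∀ (X : ℝ → EuclideanSpace ℝ (Fin 3)) (κ : ℝ), 0 ≤ κ → ContDiff ℝ 2 X →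
    (∀ τ, ‖deriv X τ‖ = 1) → (∀ τ, ‖iteratedDeriv 2 X τ‖ ≤ κ) →
    ∀ τ σ : ℝ, κ * |τ - σ| ≤ Real.pi →
      0 ≤ (τ - σ) ^ 2 - ‖X τ - X σ‖ ^ 2 ∧
      (τ - σ) ^ 2 - ‖X τ - X σ‖ ^ 2 ≤ κ ^ 2 * (τ - σ) ^ 4 / 12

/-- P2 (first checkable statement of the line). The Rosenhead distance factor along a bent
unit-speed arc differs from the straight one only at second order in the curvature bound:
relatively `O(κ² s²)`, uniformly in the core parameter `q > 0`. -/
def KernelDistanceFactorBound : Prop :=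
  ∀ (X : ℝ → EuclideanSpace ℝ (Fin 3)) (κ q : ℝ), 0 ≤ κ → 0 < q → ContDiff ℝ 2 X →
    (∀ τ, ‖deriv X τ‖ = 1) → (∀ τ, ‖iteratedDeriv 2 X τ‖ ≤ κ) →
    ∀ τ σ : ℝ, κ * |τ - σ| ≤ 1 →
      |((‖X τ - X σ‖ ^ 2 + q) ^ (3 / 2 : ℝ))⁻¹ - (((τ - σ) ^ 2 + q) ^ (3 / 2 : ℝ))⁻¹|
        ≤ 2 * κ ^ 2 * (τ - σ) ^ 4 * (((τ - σ) ^ 2 + q) ^ (5 / 2 : ℝ))⁻¹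

/-- P1 ⇒ P2 is elementary calculus (mean value theorem for `x ↦ (x+q)^{-3/2}` on
`[chord², s²]`, plus `chord² ≥ (11/12) s²` on `κ s ≤ 1`); recorded as the line's second step. -/
def KernelFactorOfChordArc : Prop := ChordArcSecondOrder → KernelDistanceFactorBound

end Summit.NavierStokesRegularity.NavierStokesRegularity.Cruxes.SkeletonJ1R.CurvatureParityTransfer
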